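import Summits.QuantumFields.YangMills.Theorems.BalabanUVNodesK0Stub1CurlCurlRowAtCubeDomains
import Summits.QuantumFields.YangMills.Theorems.BalabanUVNodesK0Stub1Letter165GtLetterAtRecord
import Summits.QuantumFields.YangMills.Theorems.BalabanUVNodesK0Stub1MultiplierLetterAtRecord
import Summits.QuantumFields.YangMills.Theorems.BalabanUVNodesN07Letters10OfRealRows
import Literature.MathematicalPhysics.QuantumFieldTheory.BalabanImbrieJaffe1984to88.BIJ85Sigma422Eta
import HarnessLib

/-!
# K0⁷ STUB 1 (`stub_prop8StepCoP13`), sub-target S4a — **THE `A₁` LINE OF THE S6 HEAD**: print's three (10)-letters `‖A₁‖, ‖∇^ηA₁‖, ‖∂^{η*}∂^ηA₁‖` of the tangent component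
# `A₁ = X − H_V(Q_VX)` on a top window `Y`, i.e. n07-w4's `Letters10On Y η_k t A₁` (the `h₁` input of `localGauge10On_of_eq159`), FROM THIS LANE's THREE ROWS — sup and gradient
# (p604735 `letter165_rows_of_critical128_bodyAt`, the port's `G̃`-letter discharged) and `∂*∂` (p610743 `curlCurl_row_of_critical128_mat`: the Δ_a-row of (158), multiplier letter
# discharged by k0-s1-w4's p607974) — through n07-w4's duality door `letters10On_of_realRows`; NO [B9] (3.49), NO Hodge identity on this road

Cell `pub-ymgap`, width seat `pub-ymgap-k0-s1-w1` g4 (INTENT-3).  `--kind proof --supports stmt-QuantumFields-20541 --as helper`; count-neutral; def-free.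
[15] = [Balaban1985Variational]; [B6] = [Balaban1984PropagatorsII]; [6] = [Balaban1985RegularSpaces].

WHY.  Print p. 304: *«This bound, the equality (159) and Eq. (158) imply |A|, |∇^ηA|, |∂^{η*}∂^ηA|, |Δ^ηA| < … (165)»*; the S6 token at NODE 00 consumes (165) per (159)-summand as
`Letters10On Y η_k tᵢ (summandᵢ)` (n07-w4 `N07HalvingStepTopOfLocalLetters.localGauge10On_of_eq159`, STEP 7 of the head's recipe).  n07-w4 delivered the `HB` summand's line
(`letters10On_HB_cubeDomains_box`); THIS FILE delivers the `A₁` summand's line from the S4a rows, in the same door currency (`letters10On_of_realRows`: per duality reading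
`y ↦ r·Re(u·f(y))` of norm `≤ 1` and per bond based in `Y`, three real rows `≤ q < t`).  The rows: `w₁‖A₁(b)‖ ≤ B₀C₄ρ²` and `w₂Lᵏ‖A₁(b + e_ν) − A₁(b)‖ ≤ B₀C₄ρ²` (p604735, [B6]
Prop. 2.2's `G̃` letters through k0-s1-w3's port) and `|∂*∂(Re φ ∘ A₁)(b)| ≤ (1 + (B₀B₃ + 1)·L·C_G)·C₄ρ²` (p610743: the Δ_a-row (131)–(133) on the slice (153) + the multiplier letter);
on a top window the (152) weights are `1`, `|Re φ(y)| ≤ ‖y‖` turns the first two into real rows, and lit's `eta_inv` (`η_k⁻¹ = Lᵏ`) matches the door's `ξ⁻¹`.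

WHAT IS PROVED (sorry-free; no definition; axioms standard).
* §1 ★★★ `letters10On_A1_of_bodyAt_adm22` — on `Site (F.P K) 0`, for a nested family `D` of top level `k` carrying k0-s1-w3's P2 body `BodyAt (F.P K) k D w B₀ δ₀ B₃` (`δ₀, B₃ ≥ 0`),
  `Adm22 D R M` with `2L ≤ R·M`, the (152) level weights, a `G_a` band sup row (displayed, k0-s1-w4's shape), p604735's S4a block (`Δ_V, G̃_V, 𝔐_V, Q_V, H_V` at `c = Lᵏ`, `a ≡ 1`;
  Prop. 4's slot `hWq`; `𝔰𝔲(N)`-valued `X`, `W X` skew∕traceless; (128); sizes `≤ ρ < a₃`) and the slice (153) for every reading of `X`: for every top window `Y ⊆ Ω_k` and every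
  `t > max{B₀, 1 + (B₀B₃ + 1)·L·C_G}·(C₄·ρ²)`: `Letters10On Y η_k t A₁` — the `A₁` LINE of (165)∕(167) at the objects.
* §2 ★★★★ `exists_letters10On_A1_closed_of_adm22_T4` — the same at EVERY admissible family of the record's tori, ALL PORT LETTERS DISCHARGED (P9 `body_of_adm22_T4` for the `G̃`∕`H`
  rows, k0-s1-w4 `gRowsBand_of_adm22_T4` for the `G_a` band row, thresholds merged): displayed ONLY `hWq` (S4b), (128) (S2), sizes (S3), the slice (153) for `X`.
HONEST SCOPE.  Composition by name (p604735 + p610743 + p607974 + P9 + n07-w4's door); NO estimate proved here.  DISPLAYED after this file for the `A₁` line: Prop. 4's slot `hWq`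
(S4b), (128) at the critical configuration (S2), the sizes `h1 h2` (S3), the slice (153) for `X` (n07-w3 at `cubeDomains` + p610743 §4 ∕ p608822
`RE_dsE_re_reading_add_HV`), and the identification of `X − H_V(Q_VX)` with the (159)-summand of the window's potential (S2∕S3: chart (157) + data).  FLAT background; nothing of
Bałaban's analysis asserted; `stub_prop8StepCoP13` ∕ K0⁷ NOT closed; N07 NOT discharged; counts unmoved (28∕28 · 5∕27); one finite 𝕋⁴ programme at fixed ε — R4 closes the
conditional finite-𝕋⁴ rung `BalabanLadder.UV` only, never the summit; the YM mass gap (Clay) is NOT proved by any of this; nothing continuum ∕ ℝ⁴ ∕ OS.  No `sorry`, no `def`,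
no `instance`, no `notation`.

References: [15] (10) p.279, (128) p.297, (131)–(133) p.298, (152)–(153) p.301, (158)–(159) pp.302–303, (165)–(167) p.304; [B6] (2.1)–(2.2) p.224, (2.19) p.226, Prop. 2.2 (2.47)
p.231, (2.35) p.228, Cor. 2.8 (2.150)–(2.151) p.249; [6] (1.2) p.76, (1.140) p.100.
-/

set_option autoImplicit false
noncomputable section
open scoped BigOperators InnerProductSpace Matrix Matrix.Norms.L2Operator

namespace Summit.QuantumFields.YangMills.Theorems.K0Stub1Letters10OnA1

open Literature.MathematicalPhysics.QuantumFieldTheory.Balaban1983to89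
open Literature.MathematicalPhysics.QuantumFieldTheory.Balaban1983to89.T4Continuum (T4Family)
open Literature.MathematicalPhysics.QuantumFieldTheory.BalabanImbrieJaffe1984to88.BIJ85AxialPropagator411 (BondSpace)
open Literature.MathematicalPhysics.QuantumFieldTheory.BalabanImbrieJaffe1984to88.BIJ85Sigma422Eta (eta_inv eta_pos)
open B6SectADomainsV1 (Domains)
open B6SectAOperatorsV1 (BondIdx BondIdxSpace QE QsE RE dsE dcE dcsE)
open B6SectAVectorModelV1 (deltaAE GE EE)
open B6SectA (hOp)
open T4AdjointCovarianceUnitary (lieSU mem_lieSU_iff)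
open Node00 (MatA)
open Summit.QuantumFields.YangMills.Theorems.FlatCubeOpsText (Adm22)
open Summit.QuantumFields.YangMills.Theorems.K0FlatCubeOpsTextP (IsLevWeight IsFlatGW GtSupLetterG BodyAt levWeight_nonneg)
open Summit.QuantumFields.YangMills.Theorems.K0FlatPortBodyP (body_of_adm22_T4)
open Summit.QuantumFields.YangMills.Theorems.K0Stub1MultiplierLetterP (multiplierLetter_matrix_of_bodyAt_adm22 levWeight_eq_one_of_inOm_top)
open Summit.QuantumFields.YangMills.Theorems.K0Stub1MultiplierLetterAtRecord (gRowsBand_of_adm22_T4)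
open Summit.QuantumFields.YangMills.Theorems.K0Stub1Letter165GtLetterAtRecord (letter165_rows_of_critical128_bodyAt)
open Summit.QuantumFields.YangMills.Theorems.K0Stub1CurlCurlRowAtCubeDomains (curlCurl_row_of_critical128_mat)
open Summit.QuantumFields.YangMills.BalabanUVNodes.N07HalvingStepTopOfLocalLetters (Letters10On)
open Summit.QuantumFields.YangMills.BalabanUVNodes.N07Letters10OfRealRows (letters10On_of_realRows)

variable {N : ℕ} [NeZero N]

/-! ## §1  The `A₁` line at a nested family carrying the P2 body -/

section Body

/-- ★★★ **THE `A₁` LINE OF (165) AT THE OBJECTS: `Letters10On Y η_k t A₁` FROM THE THREE S4a ROWS.**  On NODE 00's fine torus `Site (F.P K) 0`, for a nested family `D` of top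
level `k` with k0-s1-w3's P2 body `BodyAt (F.P K) k D w B₀ δ₀ B₃` (`δ₀, B₃ ≥ 0`), `Adm22 D R M`, `2L ≤ R·M`, the (152) level weights `w`, a `G_a` band sup row with constant `C_G`
(displayed), p604735's S4a binder block at `c = Lᵏ`, `a ≡ 1` (both `DecidableEq` instances unifiable) with the extension `𝔐_V`, and the slice (153) for every reading `Re φ ∘ X`:
for every top window `Y ⊆ Ω_k` and every `t > max{B₀, 1 + (B₀B₃ + 1)·L·C_G}·(C₄·ρ²)`, n07-w4's `Letters10On Y η_k t (X − H_V(Q_VX))` — rows 1–2 by p604735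
`letter165_rows_of_critical128_bodyAt` (weights `1` on `Y`, `|Re φ(y)| ≤ ‖y‖`), row 3 by p610743 `curlCurl_row_of_critical128_mat` with k0-s1-w4's `multiplierLetter_matrix_of_bodyAt_adm22`,
assembled by `letters10On_of_realRows` at `ξ = η_k` (`η_k⁻¹ = Lᵏ`, lit `eta_inv`).
[cite: Balaban1985Variational, (10) p.279, (152)–(153) p.301, (158)–(159) pp.302–303, (165)–(167) p.304; Balaban1984PropagatorsII, Prop. 2.2 (2.47) p.231, (2.35) p.228] -/
theorem letters10On_A1_of_bodyAt_adm22 (F : T4Family) (K k : ℕ) (D : Domains (F.P K)) (hDk : D.k = k)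
    {w : ℕ → PBond (F.P K) 0 → ℝ} (hw : IsLevWeight (F.P K) k D w) {B₀ δ₀ B₃ : ℝ} (hBody : BodyAt (F.P K) k D w B₀ δ₀ B₃) (hδ₀ : 0 ≤ δ₀) (hB₃ : 0 ≤ B₃)
    {R M : ℕ} (hAdm : Adm22 D R M) (hRM : 2 * (F.P K).L ≤ R * M)
    {a : BondIdx D → ℝ} (ha : ∀ i, 0 < a i) {G : (PBond (F.P K) 0 → ℝ) →ₗ[ℝ] (PBond (F.P K) 0 → ℝ)} (hGW : IsFlatGW (F.P K) k D ha G)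
    {CG : ℝ} (hCG : 0 ≤ CG) (hGsup : GtSupLetterG (F.P K) k w G CG)
    (hband : ∀ c : BondIdx D, a c ≤ (((F.P K).L : ℝ) ^ k) ^ ((F.P K).d - 1) * ((F.P K).L : ℝ) ^ (c.1.1 : ℕ))
    {instDE : DecidableEq (PBond (F.P K) 0)} {instDB : DecidableEq (BondIdx D)}
    {DV GV MV : (PBond (F.P K) 0 → Matrix (Fin N) (Fin N) ℂ) →ₗ[ℂ] (PBond (F.P K) 0 → Matrix (Fin N) (Fin N) ℂ)}
    {QV : (PBond (F.P K) 0 → Matrix (Fin N) (Fin N) ℂ) →ₗ[ℂ] (BondIdx D → Matrix (Fin N) (Fin N) ℂ)}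
    {HV : (BondIdx D → Matrix (Fin N) (Fin N) ℂ) →ₗ[ℂ] (PBond (F.P K) 0 → Matrix (Fin N) (Fin N) ℂ)}
    (hDV : ∀ (A : PBond (F.P K) 0 → Matrix (Fin N) (Fin N) ℂ) (b : PBond (F.P K) 0),
      DV A b = ∑ j, ((WithLp.ofLp (deltaAE D ((F.P K).L ^ k : ℝ) (fun _ => (1 : ℝ)) (WithLp.toLp 2 (Pi.single j 1))) b : ℝ) : ℂ) • A j)
    (hGV : ∀ (A : PBond (F.P K) 0 → Matrix (Fin N) (Fin N) ℂ) (b : PBond (F.P K) 0),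
      GV A b = ∑ j, ((WithLp.ofLp ((GE D (c := ((F.P K).L : ℝ) ^ k) (pow_ne_zero _ (Nat.cast_ne_zero.2 (F.P K).L_pos.ne')) (w := fun _ => (1 : ℝ)) (fun _ => one_pos)
        - hOp (GE D (c := ((F.P K).L : ℝ) ^ k) (pow_ne_zero _ (Nat.cast_ne_zero.2 (F.P K).L_pos.ne')) (w := fun _ => (1 : ℝ)) (fun _ => one_pos)) (QsE D)
            (EE D (c := ((F.P K).L : ℝ) ^ k) (pow_ne_zero _ (Nat.cast_ne_zero.2 (F.P K).L_pos.ne')) (w := fun _ => (1 : ℝ)) (fun _ => one_pos))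
          ∘ₗ QE D ∘ₗ GE D (c := ((F.P K).L : ℝ) ^ k) (pow_ne_zero _ (Nat.cast_ne_zero.2 (F.P K).L_pos.ne')) (w := fun _ => (1 : ℝ)) (fun _ => one_pos))
        (WithLp.toLp 2 (Pi.single j 1))) b : ℝ) : ℂ) • A j)
    (hQV : ∀ (A : PBond (F.P K) 0 → Matrix (Fin N) (Fin N) ℂ) (t : BondIdx D),
      QV A t = ∑ j, ((WithLp.ofLp (QE D (WithLp.toLp 2 (Pi.single j 1))) t : ℝ) : ℂ) • A j)
    (hHV : ∀ (B : BondIdx D → Matrix (Fin N) (Fin N) ℂ) (b : PBond (F.P K) 0),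
      HV B b = ∑ t, ((WithLp.ofLp (hOp (GE D (c := ((F.P K).L : ℝ) ^ k) (pow_ne_zero _ (Nat.cast_ne_zero.2 (F.P K).L_pos.ne')) (w := fun _ => (1 : ℝ)) (fun _ => one_pos))
        (QsE D) (EE D (c := ((F.P K).L : ℝ) ^ k) (pow_ne_zero _ (Nat.cast_ne_zero.2 (F.P K).L_pos.ne')) (w := fun _ => (1 : ℝ)) (fun _ => one_pos))
        (WithLp.toLp 2 (Pi.single t 1))) b : ℝ) : ℂ) • B t)
    (hMV : ∀ (A : PBond (F.P K) 0 → Matrix (Fin N) (Fin N) ℂ) (b : PBond (F.P K) 0),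
      MV A b = ∑ j, ((WithLp.ofLp ((QsE D
          ∘ₗ EE D (c := ((F.P K).L : ℝ) ^ k) (pow_ne_zero _ (Nat.cast_ne_zero.2 (F.P K).L_pos.ne')) (w := fun _ => (1 : ℝ)) (fun _ => one_pos)
          ∘ₗ QE D ∘ₗ GE D (c := ((F.P K).L : ℝ) ^ k) (pow_ne_zero _ (Nat.cast_ne_zero.2 (F.P K).L_pos.ne')) (w := fun _ => (1 : ℝ)) (fun _ => one_pos))
        (WithLp.toLp 2 (Pi.single j 1))) b : ℝ) : ℂ) • A j)
    (W : (PBond (F.P K) 0 → Matrix (Fin N) (Fin N) ℂ) → (PBond (F.P K) 0 → Matrix (Fin N) (Fin N) ℂ)) {C₄ a₃ ρ : ℝ}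
    (hWq : ∀ (Y : PBond (F.P K) 0 → Matrix (Fin N) (Fin N) ℂ) (r : ℝ), r < a₃ → (∀ b, w 1 b * ‖Y b‖ ≤ r) →
      (∀ (b : PBond (F.P K) 0) (ν : Fin 4), w 2 b * (F.L : ℝ) ^ k * ‖Y ⟨b.src.shift ν, b.dir⟩ - Y b‖ ≤ r) →
        ∀ b, w 3 b * ‖W Y b‖ ≤ C₄ * r ^ 2)
    (X : PBond (F.P K) 0 → lieSU (Fin N))
    (hWA : ∀ j, (W (fun b => ((X b : lieSU (Fin N)) : Matrix (Fin N) (Fin N) ℂ)) j)ᴴ = -(W (fun b => ((X b : lieSU (Fin N)) : Matrix (Fin N) (Fin N) ℂ)) j))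
    (hWtr : ∀ j, (W (fun b => ((X b : lieSU (Fin N)) : Matrix (Fin N) (Fin N) ℂ)) j).trace = 0)
    (h128 : ∀ δ : PBond (F.P K) 0 → lieSU (Fin N), QV (fun j => ((δ j : lieSU (Fin N)) : Matrix (Fin N) (Fin N) ℂ)) = 0 →
      ∑ j, (((δ j : lieSU (Fin N)) : Matrix (Fin N) (Fin N) ℂ)ᴴ *
        (DV (fun b => ((X b : lieSU (Fin N)) : Matrix (Fin N) (Fin N) ℂ)) j + W (fun b => ((X b : lieSU (Fin N)) : Matrix (Fin N) (Fin N) ℂ)) j)).trace.re = 0)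
    (hρ : ρ < a₃) (h1 : ∀ b, w 1 b * ‖((X b : lieSU (Fin N)) : Matrix (Fin N) (Fin N) ℂ)‖ ≤ ρ)
    (h2 : ∀ (b : PBond (F.P K) 0) (ν : Fin 4),
      w 2 b * (F.L : ℝ) ^ k * ‖((X ⟨b.src.shift ν, b.dir⟩ : lieSU (Fin N)) : Matrix (Fin N) (Fin N) ℂ) - ((X b : lieSU (Fin N)) : Matrix (Fin N) (Fin N) ℂ)‖ ≤ ρ)
    (hslice : ∀ φ : Matrix (Fin N) (Fin N) ℂ →L[ℂ] ℂ,
      RE D (((F.P K).L : ℝ) ^ k) (dsE (((F.P K).L : ℝ) ^ k) (WithLp.toLp 2 (fun b => (φ ((X b : lieSU (Fin N)) : Matrix (Fin N) (Fin N) ℂ)).re))) = 0)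
    {Y : Set (Site (F.P K) 0)} (hY : ∀ x ∈ Y, D.InOm k x) {t : ℝ}
    (ht : max B₀ (1 + (B₀ * B₃ + 1) * ((F.P K).L : ℝ) * CG) * (C₄ * ρ ^ 2) < t) :
    Letters10On Y ((F.P K).eta k) t ((fun b => ((X b : lieSU (Fin N)) : Matrix (Fin N) (Fin N) ℂ)) - HV (QV fun b => ((X b : lieSU (Fin N)) : Matrix (Fin N) (Fin N) ℂ))) := by
  have hw0 : ∀ m b, 0 ≤ w m b := fun m b => levWeight_nonneg hw m b
  -- rows 1–2 (p604735, the port's `G̃`-letters discharged on `BodyAt`)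
  obtain ⟨hrow1, hrow2, -⟩ := letter165_rows_of_critical128_bodyAt F K k D hw0 hBody hDV hGV hQV hHV W hWq X hWA hWtr h128 hρ h1 h2
  -- row 3 (p610743 with k0-s1-w4's matrix multiplier letter on the window)
  obtain ⟨Mop, hMop⟩ : ∃ Mop : (PBond (F.P K) 0 → ℝ) →ₗ[ℝ] (PBond (F.P K) 0 → ℝ), ∀ (g : PBond (F.P K) 0 → ℝ) (b : PBond (F.P K) 0),
      Mop g b = QsE D (EE D (c := ((F.P K).L : ℝ) ^ k) (pow_ne_zero _ (Nat.cast_ne_zero.2 (F.P K).L_pos.ne')) (w := fun _ => (1 : ℝ))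
        (fun _ => one_pos) (QE D (GE D (c := ((F.P K).L : ℝ) ^ k) (pow_ne_zero _ (Nat.cast_ne_zero.2 (F.P K).L_pos.ne')) (w := fun _ => (1 : ℝ))
        (fun _ => one_pos) (WithLp.toLp 2 g)))) b :=
    ⟨(WithLp.linearEquiv 2 ℝ (PBond (F.P K) 0 → ℝ)).toLinearMap ∘ₗ
        (QsE D ∘ₗ EE D (c := ((F.P K).L : ℝ) ^ k) (pow_ne_zero _ (Nat.cast_ne_zero.2 (F.P K).L_pos.ne')) (w := fun _ => (1 : ℝ)) (fun _ => one_pos) ∘ₗ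
          QE D ∘ₗ GE D (c := ((F.P K).L : ℝ) ^ k) (pow_ne_zero _ (Nat.cast_ne_zero.2 (F.P K).L_pos.ne')) (w := fun _ => (1 : ℝ)) (fun _ => one_pos)) ∘ₗ
        (WithLp.linearEquiv 2 ℝ (PBond (F.P K) 0 → ℝ)).symm.toLinearMap,
      fun _ _ => rfl⟩
  have hMmat : ∀ (g : PBond (F.P K) 0 → Matrix (Fin N) (Fin N) ℂ) (β : ℝ), 0 ≤ β → (∀ b, w 3 b * ‖g b‖ ≤ β) →
      ∀ b ∈ {b : PBond (F.P K) 0 | b.src ∈ Y}, ‖MV g b‖ ≤ ((B₀ * B₃ + 1) * ((F.P K).L : ℝ) * CG) * β := by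
    intro g β hβ hg b' hb'
    have hℳ : ∀ b, MV g b = ∑ b'', Mop (Pi.single b'' 1) b • g b'' := fun b => by
      rw [hMV]
      refine Finset.sum_congr rfl fun j _ => ?_
      rw [Complex.coe_smul, hMop]
      rfl
    exact multiplierLetter_matrix_of_bodyAt_adm22 hDk hw hBody hδ₀ hB₃ hAdm hRM ha hGW hCG hGsup hband Mop hMop hY hβ hg hℳ b' hb'
  have hrow3 := curlCurl_row_of_critical128_mat F K k w hw0 D hDV hGV hQV hHV hMV W hWq X hWA hWtr h128 hρ h1 h2 hslice
    (S := {b : PBond (F.P K) 0 | b.src ∈ Y}) (fun b hb => levWeight_eq_one_of_inOm_top hDk hw (hY _ hb) 3) hMmat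
  -- the common threshold `q`
  have hC : 0 ≤ C₄ * ρ ^ 2 :=
    (mul_nonneg (hw0 3 ⟨fun _ => 0, ⟨0, (F.P K).hd⟩⟩) (norm_nonneg _)).trans
      (hWq (fun b => ((X b : lieSU (Fin N)) : Matrix (Fin N) (Fin N) ℂ)) ρ hρ h1 h2 _)
  have hq1 : B₀ * (C₄ * ρ ^ 2) ≤ max B₀ (1 + (B₀ * B₃ + 1) * ((F.P K).L : ℝ) * CG) * (C₄ * ρ ^ 2) :=
    mul_le_mul_of_nonneg_right (le_max_left _ _) hC
  have hq3 : (1 + (B₀ * B₃ + 1) * ((F.P K).L : ℝ) * CG) * (C₄ * ρ ^ 2) ≤ max B₀ (1 + (B₀ * B₃ + 1) * ((F.P K).L : ℝ) * CG) * (C₄ * ρ ^ 2) :=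
    mul_le_mul_of_nonneg_right (le_max_right _ _) hC
  have hB₀C : 0 ≤ B₀ * (C₄ * ρ ^ 2) :=
    (mul_nonneg (hw0 1 ⟨fun _ => 0, ⟨0, (F.P K).hd⟩⟩) (norm_nonneg _)).trans (hrow1 _)
  have hq : 0 ≤ max B₀ (1 + (B₀ * B₃ + 1) * ((F.P K).L : ℝ) * CG) * (C₄ * ρ ^ 2) := hB₀C.trans hq1
  refine letters10On_of_realRows (eta_pos (F.P K) k) hq ht fun f u r hf b hb => ⟨?_, fun κ => ?_, ?_⟩
  · -- row 1: `|Re φ(A₁ b)| ≤ ‖A₁ b‖ = w₁(b)‖A₁ b‖ ≤ B₀C₄ρ²`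
    refine (hf _).trans ?_
    have h := hrow1 b
    rw [levWeight_eq_one_of_inOm_top hDk hw (hY _ hb) 1, one_mul] at h
    exact h.trans hq1
  · -- row 2: `η_k⁻¹·|Re φ(A₁ b′) − Re φ(A₁ b)| ≤ Lᵏ‖A₁ b′ − A₁ b‖ = w₂(b)Lᵏ‖…‖ ≤ B₀C₄ρ²`
    rw [eta_inv]
    have h := hrow2 b κ
    rw [levWeight_eq_one_of_inOm_top hDk hw (hY _ hb) 2, one_mul] at h
    refine le_trans ?_ (h.trans hq1)
    have hdiff : r * (u * f (((fun b => ((X b : lieSU (Fin N)) : Matrix (Fin N) (Fin N) ℂ)) - HV (QV fun b => ((X b : lieSU (Fin N)) : Matrix (Fin N) (Fin N) ℂ))) ⟨b.src.shift κ, b.dir⟩)).re - r * (u * f (((fun b => ((X b : lieSU (Fin N)) : Matrix (Fin N) (Fin N) ℂ)) - HV (QV fun b => ((X b : lieSU (Fin N)) : Matrix (Fin N) (Fin N) ℂ))) b)).re =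
        r * (u * f (((fun b => ((X b : lieSU (Fin N)) : Matrix (Fin N) (Fin N) ℂ)) - HV (QV fun b => ((X b : lieSU (Fin N)) : Matrix (Fin N) (Fin N) ℂ))) ⟨b.src.shift κ, b.dir⟩ - ((fun b => ((X b : lieSU (Fin N)) : Matrix (Fin N) (Fin N) ℂ)) - HV (QV fun b => ((X b : lieSU (Fin N)) : Matrix (Fin N) (Fin N) ℂ))) b)).re := by
      rw [map_sub, mul_sub, Complex.sub_re, mul_sub]
    rw [hdiff]
    exact mul_le_mul_of_nonneg_left (hf _) (pow_nonneg (Nat.cast_nonneg _) _)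
  · -- row 3: the Δ_a-row at `ξ⁻¹ = Lᵏ`
    rw [eta_inv]
    exact (hrow3 f u r hf b hb).trans hq3

end Body

/-! ## §2  At every admissible family of the record's tori (P9's thresholds and constants) -/

section Record

/-- ★★★★ **THE `A₁` LINE AT EVERY ADMISSIBLE FAMILY OF THE RECORD's TORI, ALL PORT LETTERS DISCHARGED** (§1 ∘ P9 `body_of_adm22_T4` ∘ k0-s1-w4 `gRowsBand_of_adm22_T4`, thresholds
merged as in `exists_multiplierLetter_closed_of_adm22_T4`): for every `F : T4Family` there are thresholds `Mh₀, R₀` and constants `B₀`, `δ₀ > 0`, `B₃ > 0`, `C_G ≥ 0` such that at every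
admissible nested family `D` of top level `K − n` (`1 ≤ K − n`, `K − n + 1 ≤ m + K`, `Adm22 D R (L·M_h)`, `M_h = L^{a′} ≥ Mh₀`, `R ≥ R₀`, `a′ + 3 ≤ m + n`), the (152) level weights, the S4a
block at `c = L^{K−n}`, `a ≡ 1` (p604735's binders: `Δ_V, G̃_V, 𝔐_V, Q_V, H_V`; Prop. 4's slot `hWq`; `𝔰𝔲(N)`-valued `X`, `W X` skew∕traceless; (128); sizes `≤ ρ < a₃`) and the slice (153) for
every reading of `X`: on every top window `Y ⊆ Ω_{K−n}` and for every `t > max{B₀, 1 + (B₀B₃ + 1)·L·C_G}·(C₄·ρ²)`, `Letters10On Y η_{K−n} t (X − H_V(Q_VX))` — NO `G̃`∕`H`∕`G`∕`Q` letter,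
NO multiplier letter, NO [B9] (3.49) displayed.
[cite: Balaban1985Variational, (10) p.279, (152)–(153) p.301, (158)–(159) pp.302–303, (165)–(167) p.304; Balaban1984PropagatorsII, (2.1)–(2.2) p.224, Prop. 2.2 (2.47) p.231, Cor. 2.8 (2.150)–(2.151) p.249] -/
theorem exists_letters10On_A1_closed_of_adm22_T4 (F : T4Family) :
    ∃ (Mh₀ R₀ : ℕ) (B₀ δ₀ B₃ CG : ℝ), 0 < δ₀ ∧ 0 < B₃ ∧ 0 ≤ CG ∧
    ∀ (n K : ℕ) (_ : 1 ≤ K - n) (_ : K - n + 1 ≤ F.m + K) {Mh R a' : ℕ} (_ : Mh = F.L ^ a') (_ : Mh₀ ≤ Mh) (_ : R₀ ≤ R)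
      (_ : a' + 3 ≤ F.m + n) (D : Domains (F.P K)) (_ : D.k = K - n) (_ : Adm22 D R (F.L * Mh))
      (w : ℕ → PBond (F.P K) 0 → ℝ) (_ : IsLevWeight (F.P K) (K - n) D w)
      {instDE : DecidableEq (PBond (F.P K) 0)} {instDB : DecidableEq (BondIdx D)}
    {DV GV MV : (PBond (F.P K) 0 → Matrix (Fin N) (Fin N) ℂ) →ₗ[ℂ] (PBond (F.P K) 0 → Matrix (Fin N) (Fin N) ℂ)}
    {QV : (PBond (F.P K) 0 → Matrix (Fin N) (Fin N) ℂ) →ₗ[ℂ] (BondIdx D → Matrix (Fin N) (Fin N) ℂ)}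
    {HV : (BondIdx D → Matrix (Fin N) (Fin N) ℂ) →ₗ[ℂ] (PBond (F.P K) 0 → Matrix (Fin N) (Fin N) ℂ)}
    (hDV : ∀ (A : PBond (F.P K) 0 → Matrix (Fin N) (Fin N) ℂ) (b : PBond (F.P K) 0),
      DV A b = ∑ j, ((WithLp.ofLp (deltaAE D ((F.P K).L ^ (K - n) : ℝ) (fun _ => (1 : ℝ)) (WithLp.toLp 2 (Pi.single j 1))) b : ℝ) : ℂ) • A j)
    (hGV : ∀ (A : PBond (F.P K) 0 → Matrix (Fin N) (Fin N) ℂ) (b : PBond (F.P K) 0),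
      GV A b = ∑ j, ((WithLp.ofLp ((GE D (c := ((F.P K).L : ℝ) ^ (K - n)) (pow_ne_zero _ (Nat.cast_ne_zero.2 (F.P K).L_pos.ne')) (w := fun _ => (1 : ℝ)) (fun _ => one_pos)
        - hOp (GE D (c := ((F.P K).L : ℝ) ^ (K - n)) (pow_ne_zero _ (Nat.cast_ne_zero.2 (F.P K).L_pos.ne')) (w := fun _ => (1 : ℝ)) (fun _ => one_pos)) (QsE D)
            (EE D (c := ((F.P K).L : ℝ) ^ (K - n)) (pow_ne_zero _ (Nat.cast_ne_zero.2 (F.P K).L_pos.ne')) (w := fun _ => (1 : ℝ)) (fun _ => one_pos))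
          ∘ₗ QE D ∘ₗ GE D (c := ((F.P K).L : ℝ) ^ (K - n)) (pow_ne_zero _ (Nat.cast_ne_zero.2 (F.P K).L_pos.ne')) (w := fun _ => (1 : ℝ)) (fun _ => one_pos))
        (WithLp.toLp 2 (Pi.single j 1))) b : ℝ) : ℂ) • A j)
    (hQV : ∀ (A : PBond (F.P K) 0 → Matrix (Fin N) (Fin N) ℂ) (t : BondIdx D),
      QV A t = ∑ j, ((WithLp.ofLp (QE D (WithLp.toLp 2 (Pi.single j 1))) t : ℝ) : ℂ) • A j)
    (hHV : ∀ (B : BondIdx D → Matrix (Fin N) (Fin N) ℂ) (b : PBond (F.P K) 0),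
      HV B b = ∑ t, ((WithLp.ofLp (hOp (GE D (c := ((F.P K).L : ℝ) ^ (K - n)) (pow_ne_zero _ (Nat.cast_ne_zero.2 (F.P K).L_pos.ne')) (w := fun _ => (1 : ℝ)) (fun _ => one_pos))
        (QsE D) (EE D (c := ((F.P K).L : ℝ) ^ (K - n)) (pow_ne_zero _ (Nat.cast_ne_zero.2 (F.P K).L_pos.ne')) (w := fun _ => (1 : ℝ)) (fun _ => one_pos))
        (WithLp.toLp 2 (Pi.single t 1))) b : ℝ) : ℂ) • B t)
    (hMV : ∀ (A : PBond (F.P K) 0 → Matrix (Fin N) (Fin N) ℂ) (b : PBond (F.P K) 0),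
      MV A b = ∑ j, ((WithLp.ofLp ((QsE D
          ∘ₗ EE D (c := ((F.P K).L : ℝ) ^ (K - n)) (pow_ne_zero _ (Nat.cast_ne_zero.2 (F.P K).L_pos.ne')) (w := fun _ => (1 : ℝ)) (fun _ => one_pos)
          ∘ₗ QE D ∘ₗ GE D (c := ((F.P K).L : ℝ) ^ (K - n)) (pow_ne_zero _ (Nat.cast_ne_zero.2 (F.P K).L_pos.ne')) (w := fun _ => (1 : ℝ)) (fun _ => one_pos))
        (WithLp.toLp 2 (Pi.single j 1))) b : ℝ) : ℂ) • A j)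
    (W : (PBond (F.P K) 0 → Matrix (Fin N) (Fin N) ℂ) → (PBond (F.P K) 0 → Matrix (Fin N) (Fin N) ℂ)) {C₄ a₃ ρ : ℝ}
    (hWq : ∀ (Y : PBond (F.P K) 0 → Matrix (Fin N) (Fin N) ℂ) (r : ℝ), r < a₃ → (∀ b, w 1 b * ‖Y b‖ ≤ r) →
      (∀ (b : PBond (F.P K) 0) (ν : Fin 4), w 2 b * (F.L : ℝ) ^ (K - n) * ‖Y ⟨b.src.shift ν, b.dir⟩ - Y b‖ ≤ r) →
        ∀ b, w 3 b * ‖W Y b‖ ≤ C₄ * r ^ 2)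
    (X : PBond (F.P K) 0 → lieSU (Fin N))
    (hWA : ∀ j, (W (fun b => ((X b : lieSU (Fin N)) : Matrix (Fin N) (Fin N) ℂ)) j)ᴴ = -(W (fun b => ((X b : lieSU (Fin N)) : Matrix (Fin N) (Fin N) ℂ)) j))
    (hWtr : ∀ j, (W (fun b => ((X b : lieSU (Fin N)) : Matrix (Fin N) (Fin N) ℂ)) j).trace = 0)
    (h128 : ∀ δ : PBond (F.P K) 0 → lieSU (Fin N), QV (fun j => ((δ j : lieSU (Fin N)) : Matrix (Fin N) (Fin N) ℂ)) = 0 →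
      ∑ j, (((δ j : lieSU (Fin N)) : Matrix (Fin N) (Fin N) ℂ)ᴴ *
        (DV (fun b => ((X b : lieSU (Fin N)) : Matrix (Fin N) (Fin N) ℂ)) j + W (fun b => ((X b : lieSU (Fin N)) : Matrix (Fin N) (Fin N) ℂ)) j)).trace.re = 0)
    (hρ : ρ < a₃) (h1 : ∀ b, w 1 b * ‖((X b : lieSU (Fin N)) : Matrix (Fin N) (Fin N) ℂ)‖ ≤ ρ)
    (h2 : ∀ (b : PBond (F.P K) 0) (ν : Fin 4),
      w 2 b * (F.L : ℝ) ^ (K - n) * ‖((X ⟨b.src.shift ν, b.dir⟩ : lieSU (Fin N)) : Matrix (Fin N) (Fin N) ℂ) - ((X b : lieSU (Fin N)) : Matrix (Fin N) (Fin N) ℂ)‖ ≤ ρ)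
    (hslice : ∀ φ : Matrix (Fin N) (Fin N) ℂ →L[ℂ] ℂ,
      RE D (((F.P K).L : ℝ) ^ (K - n)) (dsE (((F.P K).L : ℝ) ^ (K - n)) (WithLp.toLp 2 (fun b => (φ ((X b : lieSU (Fin N)) : Matrix (Fin N) (Fin N) ℂ)).re))) = 0)
      {Y : Set (Site (F.P K) 0)} (_ : ∀ x ∈ Y, D.InOm (K - n) x) {t : ℝ}
      (_ : max B₀ (1 + (B₀ * B₃ + 1) * (F.L : ℝ) * CG) * (C₄ * ρ ^ 2) < t),
      Letters10On Y ((F.P K).eta (K - n)) t ((fun b => ((X b : lieSU (Fin N)) : Matrix (Fin N) (Fin N) ℂ)) - HV (QV fun b => ((X b : lieSU (Fin N)) : Matrix (Fin N) (Fin N) ℂ))) := by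
  obtain ⟨Mh₀, R₀, B₀, δ₀, B₃, hδ₀, hB₃, hbody⟩ := body_of_adm22_T4 F
  obtain ⟨Mh₀', R₀', CG, hCG, hG⟩ := gRowsBand_of_adm22_T4 F
  refine ⟨max Mh₀ Mh₀', max (max R₀ R₀') 2, B₀, δ₀, B₃, CG, hδ₀, hB₃, hCG, ?_⟩
  intro n K hk1 hk' Mh R a' hMha hMh hR hsize D hDk hAdm w hw instDE instDB DV GV MV QV HV hDV hGV hQV hHV hMV
    W C₄ a₃ ρ hWq X hWA hWtr h128 hρ h1 h2 hslice Y hY t ht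
  have hMh₁ : Mh₀ ≤ Mh := le_trans (le_max_left _ _) hMh
  have hMh₂ : Mh₀' ≤ Mh := le_trans (le_max_right _ _) hMh
  have hR₁ : R₀ ≤ R := le_trans (le_trans (le_max_left _ _) (le_max_left _ _)) hR
  have hR₂ : R₀' ≤ R := le_trans (le_trans (le_max_right _ _) (le_max_left _ _)) hR
  have hR2 : 2 ≤ R := le_trans (le_max_right _ _) hR
  -- `2L ≤ R·(L·M_h)` from `R ≥ 2`, `M_h = L^{a′} ≥ 1` (k0-s1-w4's lines)
  have hMh1 : 1 ≤ Mh := by rw [hMha]; exact Nat.one_le_pow _ _ (F.P K).L_pos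
  have hRM : 2 * (F.P K).L ≤ R * (F.L * Mh) :=
    calc 2 * (F.P K).L ≤ R * F.L := Nat.mul_le_mul_right _ hR2
      _ = R * (F.L * 1) := by rw [mul_one]
      _ ≤ R * (F.L * Mh) := Nat.mul_le_mul_left _ (Nat.mul_le_mul_left _ hMh1)
  obtain ⟨aw, haw, G, hGW, hGsup, -, hband⟩ := hG n K hk1 hMha hMh₂ hR₂ hsize D hDk hAdm w hw
  exact letters10On_A1_of_bodyAt_adm22 F K (K - n) D hDk hw (hbody n K hk1 hk' hMha hMh₁ hR₁ hsize D hDk hAdm w hw) hδ₀.le hB₃.le hAdm hRM haw hGW hCG hGsup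
    hband hDV hGV hQV hHV hMV W hWq X hWA hWtr h128 hρ h1 h2 hslice hY ht

end Record

end Summit.QuantumFields.YangMills.Theorems.K0Stub1Letters10OnA1

end
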